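import Summits.QuantumAdvantage.QuantumAdvantage.Theorems.CubicForrelationNearExactIsExactCubicFormCellLTMatrix

/-!
# Crux `CubicForrelation.NearExactIsExact` (stmt-QuantumAdvantage-14043) — LIGHT STRUCTURE for `t̄ = T = s₀s₁s₂`: the `F`-rows of the
  gluing form `ι_{e_t} d` between the base cell (weight `< 128`) and a neighbour of weight `< 160` / `< 192` have rank `≤ 1` / `≤ 2`

Certificate seat `b2b-cforr-cert` (gen 41).  HONEST FRAMING: kernel-checked assembly (standard axioms), the `T`-analogue of
`tls_light_structure` (…CubicFormLightStructure): for a cubic `κ` on `3 + (3 + 6)` bits whose cell `v₀` has cubic form `y₀y₁y₂`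
(coordinates `U = castAdd 6 (0,1,2)`, `F = natAdd 3 (Fin 6)`) and weight `< 128` (the weight-`64` base cell of R2-PARTNER §3 (T)), and
whose neighbour `v₀ ⊕ e_t` weighs `< 160` (resp. `< 192`), the third derivative `G(j,k) = d(e_t, e_{3+j}, e_{3+k})` at the base point
satisfies `G(3+i, s) = g(i)ν(s)` (resp. that or `m(i)μ(s) ⊕ m′(i)μ′(s)`).  Ingredients: both cells have the same cubic form
(`tcc_third_rho` + `tcf_third_const`), `G = A^{(v₁)} ⊕ A^{(v₀)}` for the unit second-difference matrices of the two cells (the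
`y₀y₁y₂` corrections cancel), and `tlt_T_cell_matrix` (…CubicFormCellLTMatrix) for each cell.  This is the format `G_{F,·} = g νᵀ`,
`Γ_{F,·} = m μᵀ + m′ μ′ᵀ` of `tpa_R2_Ta/Tb` up to the Bool→tensor dictionary.  Nothing about `θ₁₂`; NOT summit progress.

* `tlt_light_structure`.

References: HOME/b2b-cforr-cert-g39/E1280-HANDPROOFS.md §1.1–1.2, App. A.3; R2-PARTNER.md §3 (T).  Axioms: the standard three.
-/

set_option linter.dupNamespace false -- D-0017: single-problem summit ⇒ `QuantumAdvantage.QuantumAdvantage` by design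

namespace Summit.QuantumAdvantage.QuantumAdvantage.Theorems.CubicForrelation.NearExactIsExact

open Finset
open Literature.Computability.QuantumComplexity
open Literature.Computability.QuantumComplexity.BuzetChailloux (bxor zeroVec bxor_comm bxor_self bxor_zeroVec zeroVec_bxor
  bxor_bxor_cancel_left)

/-- **Light structure for `T`.**  See the module docstring. [this work; E1280-HANDPROOFS §1.1–1.2] -/
theorem tlt_light_structure (κ : (Fin (3 + (3 + 6)) → Bool) → Bool) (hκ : IsDegLeFun 3 κ) (v₀ : Fin 3 → Bool)
    (hT : ∀ u v w x : Fin (3 + 6) → Bool,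
      ((((fun s => κ (Fin.append v₀ s)) x ^^ (fun s => κ (Fin.append v₀ s)) (bxor x w)) ^^ ((fun s => κ (Fin.append v₀ s)) (bxor x v) ^^ (fun s => κ (Fin.append v₀ s)) (bxor (bxor x v) w))) ^^
          (((fun s => κ (Fin.append v₀ s)) (bxor x u) ^^ (fun s => κ (Fin.append v₀ s)) (bxor (bxor x u) w)) ^^ ((fun s => κ (Fin.append v₀ s)) (bxor (bxor x u) v) ^^ (fun s => κ (Fin.append v₀ s)) (bxor (bxor (bxor x u) v) w)))) =
        ((((u (Fin.castAdd 6 0) && (v (Fin.castAdd 6 1) && w (Fin.castAdd 6 2))) ^^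
              (u (Fin.castAdd 6 0) && (v (Fin.castAdd 6 2) && w (Fin.castAdd 6 1)))) ^^
            ((u (Fin.castAdd 6 1) && (v (Fin.castAdd 6 0) && w (Fin.castAdd 6 2))) ^^
              (u (Fin.castAdd 6 1) && (v (Fin.castAdd 6 2) && w (Fin.castAdd 6 0))))) ^^
          ((u (Fin.castAdd 6 2) && (v (Fin.castAdd 6 0) && w (Fin.castAdd 6 1))) ^^
            (u (Fin.castAdd 6 2) && (v (Fin.castAdd 6 1) && w (Fin.castAdd 6 0))))))
    (t : Fin 3) :
    let x₀ : Fin (3 + (3 + 6)) → Bool := Fin.append v₀ zeroVec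
    let e3 : Fin (3 + (3 + 6)) → Bool := fun l => decide (l = Fin.castAdd (3 + 6) t)
    let eS : Fin (3 + 6) → (Fin (3 + (3 + 6)) → Bool) := fun s l => decide (l = Fin.natAdd 3 s)
    let G : Fin (3 + 6) → Fin (3 + 6) → Bool := fun j k =>
      (((κ x₀ ^^ κ (bxor x₀ (eS k))) ^^ (κ (bxor x₀ (eS j)) ^^ κ (bxor (bxor x₀ (eS j)) (eS k)))) ^^
        ((κ (bxor x₀ e3) ^^ κ (bxor (bxor x₀ e3) (eS k))) ^^
          (κ (bxor (bxor x₀ e3) (eS j)) ^^ κ (bxor (bxor (bxor x₀ e3) (eS j)) (eS k)))))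
    (#(univ.filter fun y : Fin (3 + 6) → Bool => κ (Fin.append v₀ y) = true) < 128 → #(univ.filter fun y : Fin (3 + 6) → Bool => κ (Fin.append (bxor v₀ (fun l => decide (l = t))) y) = true) < 160 →
      (∃ (g : Fin 6 → Bool) (ν : Fin (3 + 6) → Bool), ∀ i s, G (Fin.natAdd 3 i) s = (g i && ν s))) ∧
    (#(univ.filter fun y : Fin (3 + 6) → Bool => κ (Fin.append v₀ y) = true) < 128 → #(univ.filter fun y : Fin (3 + 6) → Bool => κ (Fin.append (bxor v₀ (fun l => decide (l = t))) y) = true) < 192 →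
      (∃ (g : Fin 6 → Bool) (ν : Fin (3 + 6) → Bool), ∀ i s, G (Fin.natAdd 3 i) s = (g i && ν s)) ∨
      (∃ (m m' : Fin 6 → Bool) (μ μ' : Fin (3 + 6) → Bool), ∀ i s, G (Fin.natAdd 3 i) s = ((m i && μ s) ^^ (m' i && μ' s)))) := by
  classical
  intro x₀ e3 eS G
  -- the neighbour has the same cubic form
  have hT₁ : ∀ u v w x : Fin (3 + 6) → Bool,
      ((((fun s => κ (Fin.append (bxor v₀ (fun l => decide (l = t))) s)) x ^^ (fun s => κ (Fin.append (bxor v₀ (fun l => decide (l = t))) s)) (bxor x w)) ^^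
          ((fun s => κ (Fin.append (bxor v₀ (fun l => decide (l = t))) s)) (bxor x v) ^^ (fun s => κ (Fin.append (bxor v₀ (fun l => decide (l = t))) s)) (bxor (bxor x v) w))) ^^
        (((fun s => κ (Fin.append (bxor v₀ (fun l => decide (l = t))) s)) (bxor x u) ^^ (fun s => κ (Fin.append (bxor v₀ (fun l => decide (l = t))) s)) (bxor (bxor x u) w)) ^^
          ((fun s => κ (Fin.append (bxor v₀ (fun l => decide (l = t))) s)) (bxor (bxor x u) v) ^^ (fun s => κ (Fin.append (bxor v₀ (fun l => decide (l = t))) s)) (bxor (bxor (bxor x u) v) w)))) =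
        ((((u (Fin.castAdd 6 0) && (v (Fin.castAdd 6 1) && w (Fin.castAdd 6 2))) ^^
              (u (Fin.castAdd 6 0) && (v (Fin.castAdd 6 2) && w (Fin.castAdd 6 1)))) ^^
            ((u (Fin.castAdd 6 1) && (v (Fin.castAdd 6 0) && w (Fin.castAdd 6 2))) ^^
              (u (Fin.castAdd 6 1) && (v (Fin.castAdd 6 2) && w (Fin.castAdd 6 0))))) ^^
          ((u (Fin.castAdd 6 2) && (v (Fin.castAdd 6 0) && w (Fin.castAdd 6 1))) ^^
            (u (Fin.castAdd 6 2) && (v (Fin.castAdd 6 1) && w (Fin.castAdd 6 0))))) := by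
    intro u v w x
    rw [← hT u v w x]
    have e1 := tcc_third_rho κ (bxor v₀ (fun l => decide (l = t))) u v w x
    have e2 := tcc_third_rho κ v₀ u v w x
    simp only at e1 e2
    rw [e1, e2]
    exact tcf_third_const κ hκ _ _ _ _ _
  -- the unit second-difference matrices of the two cells (with the common `y₀y₁y₂` correction)
  set Q₀ : (Fin (3 + 6) → Bool) → Bool := fun z =>
    κ (Fin.append v₀ z) ^^ ((z (Fin.castAdd 6 0) && z (Fin.castAdd 6 1)) && z (Fin.castAdd 6 2)) with hQ₀
  set Q₁ : (Fin (3 + 6) → Bool) → Bool := fun z =>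
    κ (Fin.append (bxor v₀ (fun l => decide (l = t))) z) ^^ ((z (Fin.castAdd 6 0) && z (Fin.castAdd 6 1)) && z (Fin.castAdd 6 2)) with hQ₁
  set A₀ : Fin (3 + 6) → Fin (3 + 6) → Bool := fun j k =>
    (Q₀ zeroVec ^^ Q₀ (fun l => decide (l = k))) ^^ (Q₀ (fun l => decide (l = j)) ^^ Q₀ (bxor (fun l => decide (l = j)) (fun l => decide (l = k))))
    with hA₀
  set A₁ : Fin (3 + 6) → Fin (3 + 6) → Bool := fun j k =>
    (Q₁ zeroVec ^^ Q₁ (fun l => decide (l = k))) ^^ (Q₁ (fun l => decide (l = j)) ^^ Q₁ (bxor (fun l => decide (l = j)) (fun l => decide (l = k))))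
    with hA₁
  have M₀ : 64 ≤ #(univ.filter fun y : Fin (3 + 6) → Bool => κ (Fin.append v₀ y) = true) ∧
      (#(univ.filter fun y : Fin (3 + 6) → Bool => κ (Fin.append v₀ y) = true) < 128 → ∀ i s, A₀ (Fin.natAdd 3 i) s = false) ∧
      (#(univ.filter fun y : Fin (3 + 6) → Bool => κ (Fin.append v₀ y) = true) < 160 → ∃ (g : Fin 6 → Bool) (ν : Fin (3 + 6) → Bool), ∀ i s, A₀ (Fin.natAdd 3 i) s = (g i && ν s)) ∧
      (#(univ.filter fun y : Fin (3 + 6) → Bool => κ (Fin.append v₀ y) = true) < 192 →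
        (∃ (g : Fin 6 → Bool) (ν : Fin (3 + 6) → Bool), ∀ i s, A₀ (Fin.natAdd 3 i) s = (g i && ν s)) ∨
        (∃ (m m' : Fin 6 → Bool) (μ μ' : Fin (3 + 6) → Bool), ∀ i s, A₀ (Fin.natAdd 3 i) s = ((m i && μ s) ^^ (m' i && μ' s)))) :=
    tlt_T_cell_matrix (fun s => κ (Fin.append v₀ s)) hT
  have M₁ : 64 ≤ #(univ.filter fun y : Fin (3 + 6) → Bool => κ (Fin.append (bxor v₀ (fun l => decide (l = t))) y) = true) ∧
      (#(univ.filter fun y : Fin (3 + 6) → Bool => κ (Fin.append (bxor v₀ (fun l => decide (l = t))) y) = true) < 128 → ∀ i s, A₁ (Fin.natAdd 3 i) s = false) ∧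
      (#(univ.filter fun y : Fin (3 + 6) → Bool => κ (Fin.append (bxor v₀ (fun l => decide (l = t))) y) = true) < 160 → ∃ (g : Fin 6 → Bool) (ν : Fin (3 + 6) → Bool), ∀ i s, A₁ (Fin.natAdd 3 i) s = (g i && ν s)) ∧
      (#(univ.filter fun y : Fin (3 + 6) → Bool => κ (Fin.append (bxor v₀ (fun l => decide (l = t))) y) = true) < 192 →
        (∃ (g : Fin 6 → Bool) (ν : Fin (3 + 6) → Bool), ∀ i s, A₁ (Fin.natAdd 3 i) s = (g i && ν s)) ∨
        (∃ (m m' : Fin 6 → Bool) (μ μ' : Fin (3 + 6) → Bool), ∀ i s, A₁ (Fin.natAdd 3 i) s = ((m i && μ s) ^^ (m' i && μ' s)))) :=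
    tlt_T_cell_matrix (fun s => κ (Fin.append (bxor v₀ (fun l => decide (l = t))) s)) hT₁
  -- `G = A₁ ⊕ A₀`
  have key : ∀ j k, G j k = (A₁ j k ^^ A₀ j k) := by
    intro j k
    simp only [G, x₀, e3, eS, hA₀, hA₁, hQ₀, hQ₁]
    rw [tcc_unit_left t, tcc_unit_right j, tcc_unit_right k]
    simp only [tcc_append_bxor, bxor_zeroVec, zeroVec_bxor]
    generalize κ (Fin.append v₀ zeroVec) = a₁
    generalize κ (Fin.append v₀ (fun l => decide (l = k))) = a₂
    generalize κ (Fin.append v₀ (fun l => decide (l = j))) = a₃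
    generalize κ (Fin.append v₀ (bxor (fun l => decide (l = j)) (fun l => decide (l = k)))) = a₄
    generalize κ (Fin.append (bxor v₀ (fun l => decide (l = t))) zeroVec) = a₅
    generalize κ (Fin.append (bxor v₀ (fun l => decide (l = t))) (fun l => decide (l = k))) = a₆
    generalize κ (Fin.append (bxor v₀ (fun l => decide (l = t))) (fun l => decide (l = j))) = a₇
    generalize κ (Fin.append (bxor v₀ (fun l => decide (l = t))) (bxor (fun l => decide (l = j)) (fun l => decide (l = k)))) = a₈
    generalize (((zeroVec : Fin (3 + 6) → Bool) (Fin.castAdd 6 0) && (zeroVec : Fin (3 + 6) → Bool) (Fin.castAdd 6 1)) &&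
      (zeroVec : Fin (3 + 6) → Bool) (Fin.castAdd 6 2)) = n₁
    generalize (((fun l => decide (l = k)) (Fin.castAdd 6 0) && (fun l => decide (l = k)) (Fin.castAdd 6 1)) &&
      (fun l => decide (l = k)) (Fin.castAdd 6 2)) = n₂
    generalize (((fun l => decide (l = j)) (Fin.castAdd 6 0) && (fun l => decide (l = j)) (Fin.castAdd 6 1)) &&
      (fun l => decide (l = j)) (Fin.castAdd 6 2)) = n₃
    generalize (((bxor (fun l => decide (l = j)) (fun l => decide (l = k))) (Fin.castAdd 6 0) &&
      (bxor (fun l => decide (l = j)) (fun l => decide (l = k))) (Fin.castAdd 6 1)) &&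
      (bxor (fun l => decide (l = j)) (fun l => decide (l = k))) (Fin.castAdd 6 2)) = n₄
    revert a₁ a₂ a₃ a₄ a₅ a₆ a₇ a₈ n₁ n₂ n₃ n₄
    decide
  refine ⟨fun h128 h160 => ?_, fun h128 h192 => ?_⟩
  · have hz := M₀.2.1 h128
    obtain ⟨g, ν, hg⟩ := M₁.2.2.1 h160
    exact ⟨g, ν, fun i s => by rw [key, hz, hg, Bool.xor_false]⟩
  · have hz := M₀.2.1 h128
    rcases M₁.2.2.2 h192 with ⟨g, ν, hg⟩ | ⟨m, m', μ, μ', hm⟩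
    · exact Or.inl ⟨g, ν, fun i s => by rw [key, hz, hg, Bool.xor_false]⟩
    · exact Or.inr ⟨m, m', μ, μ', fun i s => by rw [key, hz, hm, Bool.xor_false]⟩

end Summit.QuantumAdvantage.QuantumAdvantage.Theorems.CubicForrelation.NearExactIsExact
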